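import Mathlib
import Summits.NavierStokesRegularity.NavierStokesRegularity.Theorems.FilamentSkeletonRssKelvinGatePressureGradient
import Literature.Analysis.FluidPDE.BiotSavartNewtonKernel
import Literature.Analysis.FluidPDE.HelmholtzAnnihilator
import Literature.Analysis.FluidPDE.LerayHopfMild
import Literature.Analysis.FluidPDE.LerayProfileCalculus

/-!
# Route `FilamentSkeletonRss` · crux `TransverseReductionRJ` (stmt-NavierStokesRegularity-21221) — line `kelvin_gate`,
# stub S2′ `EventualKelvinGate`: the FREE PRESSURE solves `ΔQ = div F` in `𝒟′(ℝ³)`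

Helper file (theorems only, `--supports stmt-NavierStokesRegularity-21221 --as helper`).  HONEST FRAMING: analysis
bookkeeping for a HYPOTHETICAL filament-type rotating-self-similar blow-up route; nothing here bears on Navier–Stokes
regularity; no stub is proved here.

Continuation of `…KelvinGatePressureDecay` / `…PressureGradient`.  For a continuous real density `f` with
`(1+|y|)²|f| ≤ R` (NOT integrable: the compact-support / `L¹` theory of the tree does not apply) and a test function
`φ ∈ C³_c(ℝ³)`:

* `integral_fderiv_newtonKernel_mul_laplacian` — `∫ ∂ₐΓ(x − y) Δφ(x) dx = −∂ₐφ(y)` (oddness of `∂ₐΓ`, the tree's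
  integration by parts against `Γ ∈ W^{1,1}_loc` and Green's representation `∫ Γ(y − x) Δψ(x) dx = ψ(y)`);
* `integral_norm_fderiv_newtonKernel_smul_le_of_sq_weight` — `∫ ‖∂ₐΓ(x − y) • g(y)‖ dy ≤ (‖a‖R/4π)·12V/(1+|x|)`;
* `integral_newtonGradPotential_mul_laplacian` — **`∫ T_a f · Δφ = −∫ f · ∂ₐφ`** (Fubini on `ℝ³ × ℝ³`, the double
  integral converging absolutely by the weighted dipole bound): the dipole potential `T_a f = ∂ₐΓ ⋆ f` solves
  `Δ(T_a f) = ∂ₐ f` in the sense of distributions.  Summing over `a = eⱼ`, `f = Fⱼ`: the free pressure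
  `Q = Σⱼ T_{eⱼ}Fⱼ` of the Kelvin gate solves `ΔQ = div F` in `𝒟′`, i.e. `F − ∇Q` is weakly divergence-free
  (evidence #28, route R1, input of step (P3)).
-/

set_option linter.dupNamespace false

noncomputable section

namespace Summit.NavierStokesRegularity.NavierStokesRegularity.Theorems.KelvinGate

open Set Function Filter MeasureTheory Metric Real
open Literature.Analysis.FluidPDE Literature.Analysis.FluidPDE.NewtonPotentialHolder
open scoped ENNReal Topology Laplacian RealInnerProductSpace

/-! ## The kernel identity `∫ ∂ₐΓ(x − y) Δφ(x) dx = −∂ₐφ(y)` -/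

/-- `∂ₐΓ` is odd: `DΓ(x − y) a = −DΓ(y − x) a` (both sides are the junk value `0` at `x = y`). -/
theorem fderiv_newtonKernel_sub_comm (x y a : EuclideanSpace ℝ (Fin 3)) :
    fderiv ℝ newtonKernel (x - y) a = -fderiv ℝ newtonKernel (y - x) a := by
  by_cases h : x = y
  · subst h
    rw [sub_self, fderiv_newtonKernel_zero, zero_apply, neg_zero]
  · have hxy : x - y ≠ 0 := sub_ne_zero.2 h
    have hyx : y - x ≠ 0 := sub_ne_zero.2 (Ne.symm h)
    rw [fderiv_newtonKernel_apply hxy, fderiv_newtonKernel_apply hyx, ← neg_sub y x, inner_neg_left, norm_neg,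
      neg_div]

/-- **`∫ ∂ₐΓ(x − y) Δφ(x) dx = −∂ₐφ(y)`** for `φ ∈ C³_c(ℝ³)`: the dipole kernel tested against a Laplacian
(oddness, `∫ Γ(y − x) ∂ₐΨ(x) dx = ∫ ∂ₐΓ(y − x) Ψ(x) dx` with `Ψ = Δφ`, `∂ₐΔφ = Δ∂ₐφ`, and Green's representation
formula applied to `∂ₐφ`). -/
theorem integral_fderiv_newtonKernel_mul_laplacian {φ : EuclideanSpace ℝ (Fin 3) → ℝ} (hφ : ContDiff ℝ 3 φ)
    (hc : HasCompactSupport φ) (y a : EuclideanSpace ℝ (Fin 3)) :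
    ∫ x, fderiv ℝ newtonKernel (x - y) a * Δ φ x = -fderiv ℝ φ y a := by
  have h1 : (fun x => fderiv ℝ newtonKernel (x - y) a * Δ φ x) =
      fun x => -(fderiv ℝ newtonKernel (y - x) a * Δ φ x) := by
    funext x; rw [fderiv_newtonKernel_sub_comm, neg_mul]
  rw [h1, integral_neg]
  congr 1
  have hΔ1 : ContDiff ℝ 1 (Δ φ) := contDiff_one_laplacian hφ
  have hΔc : HasCompactSupport (Δ φ) := hasCompactSupport_laplacian hc
  have h2 := integral_newtonKernel_smul_fderiv_eq hΔ1 hΔc y a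
  simp only [smul_eq_mul] at h2
  rw [← h2]
  have h3 : (fun x => newtonKernel (y - x) * fderiv ℝ (Δ φ) x a) =
      fun x => newtonKernel (y - x) * Δ (fun z => fderiv ℝ φ z a) x := by
    funext x; rw [fderiv_laplacian_apply hφ x a]
  rw [h3]
  exact integral_newtonKernel_mul_laplacian ((hφ.fderiv_right (m := 2) (by norm_num)).clm_apply contDiff_const)
    (hc.fderiv_apply (𝕜 := ℝ) a) y

/-! ## `L¹` form of the weighted dipole bound -/

section Banach

variable {G : Type*} [NormedAddCommGroup G] [NormedSpace ℝ G]

/-- `∫ ‖∂ₐΓ(x − y) • g(y)‖ dy ≤ (‖a‖R/4π) · 12V/(1+|x|)` for a density with `(1+|y|)²‖g‖ ≤ R`. -/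
theorem integral_norm_fderiv_newtonKernel_smul_le_of_sq_weight {g : EuclideanSpace ℝ (Fin 3) → G} {R : ℝ}
    (hg : ∀ y, (1 + ‖y‖) ^ 2 * ‖g y‖ ≤ R) (a x : EuclideanSpace ℝ (Fin 3)) :
    ∫ y, ‖fderiv ℝ newtonKernel (x - y) a • g y‖ ≤
      ‖a‖ * R / (4 * π) * (12 * (3 * (volume : Measure (EuclideanSpace ℝ (Fin 3))).real (ball 0 1)) / (1 + ‖x‖)) := by
  have hR : 0 ≤ R := le_trans (by positivity) (hg 0)
  obtain ⟨hb, hI⟩ := integral_norm_sub_rpow_neg_two_mul_inv_weight_sq_le x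
  have h0 : (volume : Measure (EuclideanSpace ℝ (Fin 3))) {x} = 0 := measure_singleton x
  have hbound : ∀ᵐ y ∂(volume : Measure (EuclideanSpace ℝ (Fin 3))),
      ‖fderiv ℝ newtonKernel (x - y) a • g y‖ ≤ ‖a‖ * R / (4 * π) * (‖x - y‖ ^ (-(2:ℝ)) * ((1 + ‖y‖) ^ 2)⁻¹) := by
    filter_upwards [compl_mem_ae_iff.2 h0] with y hy
    have hyx : y ≠ x := by simpa using hy
    exact norm_fderiv_newtonKernel_smul_le_of_sq_weight hg a hyx
  calc ∫ y, ‖fderiv ℝ newtonKernel (x - y) a • g y‖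
      ≤ ∫ y, ‖a‖ * R / (4 * π) * (‖x - y‖ ^ (-(2:ℝ)) * ((1 + ‖y‖) ^ 2)⁻¹) :=
        integral_mono_of_nonneg (Eventually.of_forall fun y => norm_nonneg _) (hb.const_mul _) hbound
    _ = ‖a‖ * R / (4 * π) * ∫ y, ‖x - y‖ ^ (-(2:ℝ)) * ((1 + ‖y‖) ^ 2)⁻¹ := integral_const_mul _ _
    _ ≤ ‖a‖ * R / (4 * π) * (12 * (3 * (volume : Measure (EuclideanSpace ℝ (Fin 3))).real (ball 0 1)) / (1 + ‖x‖)) :=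
        mul_le_mul_of_nonneg_left hI (by positivity)

end Banach

/-! ## `Δ(T_a f) = ∂ₐf` in `𝒟′` -/

/-- **The dipole potential of a `⟨y⟩⁻²` density solves `Δ(T_a f) = ∂ₐ f` in the sense of distributions**:
for `f` continuous with `(1+|y|)²|f| ≤ R` and `φ ∈ C³_c(ℝ³)`, `∫ T_a f(x) Δφ(x) dx = −∫ f(y) ∂ₐφ(y) dy`
(Fubini: the double integral `∫∫ |∂ₐΓ(x − y)| |f(y)| |Δφ(x)| dy dx ≤ (‖a‖R/4π)·12V ∫|Δφ| < ∞`). -/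
theorem integral_newtonGradPotential_mul_laplacian {f : EuclideanSpace ℝ (Fin 3) → ℝ} (hfc : Continuous f) {R : ℝ}
    (hf : ∀ y, (1 + ‖y‖) ^ 2 * |f y| ≤ R) {φ : EuclideanSpace ℝ (Fin 3) → ℝ} (hφ : ContDiff ℝ 3 φ)
    (hφc : HasCompactSupport φ) (a : EuclideanSpace ℝ (Fin 3)) :
    ∫ x, newtonGradPotential a f x * Δ φ x = -∫ y, f y * fderiv ℝ φ y a := by
  have hR : 0 ≤ R := le_trans (by positivity) (hf 0)
  have hf' : ∀ y, (1 + ‖y‖) ^ 2 * ‖f y‖ ≤ R := fun y => by rw [Real.norm_eq_abs]; exact hf y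
  have hΔc : Continuous (Δ φ) := (contDiff_one_laplacian hφ).continuous
  have hΔs : HasCompactSupport (Δ φ) := hasCompactSupport_laplacian hφc
  set V : ℝ := 3 * (volume : Measure (EuclideanSpace ℝ (Fin 3))).real (ball 0 1) with hV
  have hV0 : 0 ≤ V := three_mul_volume_real_ball_nonneg
  set c : ℝ := ‖a‖ * R / (4 * π) with hcdef
  have hc0 : 0 ≤ c := by positivity
  -- the integrand on `ℝ³ × ℝ³`
  set Gf : EuclideanSpace ℝ (Fin 3) → EuclideanSpace ℝ (Fin 3) → ℝ :=
    fun x y => fderiv ℝ newtonKernel (x - y) a * f y * Δ φ x with hGf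
  have hmeas : Measurable (uncurry Gf) :=
    ((((measurable_fderiv_apply_const ℝ newtonKernel a).comp (measurable_fst.sub measurable_snd)).mul
      (hfc.measurable.comp measurable_snd)).mul (hΔc.measurable.comp measurable_fst))
  -- slice bound: `∫ |G(x, ·)| ≤ c · 12V · |Δφ(x)|`
  have hslice : ∀ x, ∫ y, ‖Gf x y‖ ≤ c * (12 * V) * ‖Δ φ x‖ := by
    intro x
    have hx1 : 1 ≤ 1 + ‖x‖ := by linarith [norm_nonneg x]
    have e : (fun y => ‖Gf x y‖) = fun y => ‖fderiv ℝ newtonKernel (x - y) a • f y‖ * ‖Δ φ x‖ := by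
      funext y; rw [hGf]; dsimp only; rw [norm_mul, smul_eq_mul]
    rw [e, integral_mul_const]
    have h := integral_norm_fderiv_newtonKernel_smul_le_of_sq_weight hf' a x
    calc (∫ y, ‖fderiv ℝ newtonKernel (x - y) a • f y‖) * ‖Δ φ x‖
        ≤ c * (12 * V / (1 + ‖x‖)) * ‖Δ φ x‖ := mul_le_mul_of_nonneg_right h (norm_nonneg _)
      _ ≤ c * (12 * V) * ‖Δ φ x‖ := by
          refine mul_le_mul_of_nonneg_right (mul_le_mul_of_nonneg_left ?_ hc0) (norm_nonneg _)
          exact div_le_self (by positivity) hx1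
  have hG : Integrable (uncurry Gf) ((volume : Measure (EuclideanSpace ℝ (Fin 3))).prod volume) := by
    refine (integrable_prod_iff hmeas.aestronglyMeasurable).2 ⟨Eventually.of_forall fun x => ?_, ?_⟩
    · have h := (integrable_fderiv_newtonKernel_mul_of_sq_weight hfc.aestronglyMeasurable hf a x).mul_const (Δ φ x)
      exact h
    · refine Integrable.mono' (((hΔc.norm).integrable_of_hasCompactSupport hΔs.norm).const_mul (c * (12 * V)))
        hmeas.aestronglyMeasurable.norm.integral_prod_right' (Eventually.of_forall fun x => ?_)
      rw [Real.norm_of_nonneg (integral_nonneg fun y => norm_nonneg _)]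
      exact hslice x
  -- rewrite both sides as iterated integrals and swap
  have hL : (fun x => newtonGradPotential a f x * Δ φ x) = fun x => ∫ y, Gf x y := by
    funext x
    rw [hGf]; dsimp only
    rw [newtonGradPotential, ← integral_mul_const]
    simp only [smul_eq_mul]
  rw [hL, integral_integral_swap hG]
  have hinner : ∀ y, ∫ x, Gf x y = f y * -fderiv ℝ φ y a := by
    intro y
    rw [← integral_fderiv_newtonKernel_mul_laplacian hφ hφc y a, ← integral_const_mul]
    refine integral_congr_ae (Eventually.of_forall fun x => ?_)
    rw [hGf]; dsimp only; ring
  simp_rw [hinner]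
  rw [← integral_neg]
  refine integral_congr_ae (Eventually.of_forall fun y => ?_)
  ring

end Summit.NavierStokesRegularity.NavierStokesRegularity.Theorems.KelvinGate

end
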